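/-
Copyright: the b2b-balaban cell (near-miss cell 7), T⁴-continuum fan-out, lineage t4-ne7b-p3 (node U5c LARGE-DEVIATION
member P3).  Released under the licence of the surrounding project.
-/
import Mathlib.Analysis.Complex.ExponentialBounds
import Summits.QuantumFields.BalabanUV.T4Continuum.Support.SpaceTimeBankedRate

/-!
# Space-time Peierls ∕ Cramér route for NE7b — THE SURVIVAL CONDITION COSTS ONE INFRARED THRESHOLD (skeleton row ST10:
# the constants; «p₀(g)∕N > c·log L, automatic in the printed window» in kernel form for the CONTOUR route)

Summits-side support leaf of the T⁴-continuum cell (rung (B)+1 on a FINITE torus only; NOT infinite volume, NOT the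
mass gap, NOT the Clay statement; NOT a proof of the spine estimate NE7b).  Lineage `t4-ne7b-p3` (generation 2), node
U5c, skeleton `t4/skeletons/NE7b-t4-ne7b-p3.md` §0 (iv) ∕ §5, row ST10.  [folklore] real arithmetic over the COUNT
member's printed-shape constants `T4PrintedShapeBanking.Consts` and its infrared threshold `exists_irThreshold` (lineage
t4-ne7b-p1) — imported BY NAME, nothing modified; nothing is quoted from print and nothing printed is asserted; no
`[cite:]` tag.

WHAT.  The CONTOUR route survives iff `ϱ = Δ₁·e^{−s₁} < 1` (`SpaceTimePeierls.rate_lt_one_iff`), where `Δ₁` is the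
site-animal constant (A1, `SpaceTimeCells`: `(3^d + L^d + 2)²`) and `s₁ = rateB − c₃` is the per-cell banked rate of
`SpaceTimeBankedRate` net of the history multiplicity `c₃` per cell (A3f).  With the bank rates `κ₁ = Eb = T·C₂`,
`μ = T·C₁` the rate IS `T` (§2 `rateB_withBanks`), so choosing `T > log Δ₁ + c₃` (§1 `survivalRate`) makes the route
survive (§2 `survival_withBanks`) — and the COUNT member's `exists_irThreshold`, applied to the constants with these
banks, still yields ONE number `x₀`, free of the cutoff, past which (`log g_K⁻² ≥ x₀`) print's four banking binders
hold along every run of the typed flow ((2.7), (2.9), (2.5), `1 ≤ log g_s⁻²`) (§3 `exists_irThreshold_withBanks`).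
So the survival condition of the route is a threshold on the RENORMALISED coupling only, uniform in `K` — the same
logical status as print's «for p₀ large and γ small enough» and as the COUNT member's `irThresholdZ`; no separate
condition «p̄₀∕N′ > c·log L» remains.  Nothing here is an estimate of Bałaban's.

HONEST DEPENDENCY (cell, verbatim): continuum YM on T⁴ ⇐ BetaPertH ∧ nine spine estimates (0/9 proved); BetaPertH ⇐
(D1) ∧ (D4) ∧ CAP+tail; G-an2-4 gates asym, D1 and NE2/3/4.  This file changes none of it.
-/

namespace Summit.QuantumFields.BalabanUV.T4Continuum.SpaceTimePeierls

open Literature.MathematicalPhysics.QuantumFieldTheory.Balaban1983to89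
open T4PersistenceDictionary T4BankedInduction T4PrintedShapeBanking SpaceTimePeierlsLeaves

noncomputable section

/-! ## §1 Survival arithmetic -/

section Survival

/-- **A RATE ABOVE `log Δ₁ + c₃` SURVIVES**: `Δ₁ · e^{−(r − c₃)} < 1`. [folklore] -/
theorem survives_of_lt {Δ₁ c₃ r : ℝ} (hΔ : 0 < Δ₁) (h : Real.log Δ₁ + c₃ < r) :
    Δ₁ * Real.exp (-(r - c₃)) < 1 := by
  have h1 : Δ₁ * Real.exp (-(r - c₃)) = Real.exp (Real.log Δ₁ + -(r - c₃)) := by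
    rw [Real.exp_add, Real.exp_log hΔ]
  rw [h1, Real.exp_lt_one_iff]
  linarith

/-- **THE SURVIVAL RATE** chosen by the route: `max 0 (log Δ₁ + c₃ + 1)`. [folklore] -/
def survivalRate (Δ₁ c₃ : ℝ) : ℝ := max 0 (Real.log Δ₁ + c₃ + 1)

/-- the survival rate is nonnegative [folklore] -/
theorem survivalRate_nonneg (Δ₁ c₃ : ℝ) : 0 ≤ survivalRate Δ₁ c₃ := le_max_left _ _

/-- the survival rate exceeds `log Δ₁ + c₃` [folklore] -/
theorem lt_survivalRate (Δ₁ c₃ : ℝ) : Real.log Δ₁ + c₃ < survivalRate Δ₁ c₃ :=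
  lt_of_lt_of_le (by linarith) (le_max_right _ _)

end Survival

/-! ## §2 The banks at a prescribed rate -/

section Banks

/-- **THE CONSTANTS WITH BANKS AT RATE `T`**: the COUNT member's printed-shape constants with the bank rates replaced by
`κ₁ := T·C₂`, `Eb := T·C₂`, `μ := T·C₁` (every other field — `n₁, dC, q′, E₂, E₃, E₀, a, A₀, p₀`, hence the costs,
credits, reserves, extensions and the admissibility `Consistent` — unchanged). [folklore] -/
def withBanks (C : T4PrintedShapeBanking.Consts) (T C₁ C₂ : ℝ) : T4PrintedShapeBanking.Consts :=
  { C with κ₁ := T * C₂, Eb := T * C₂, μ := T * C₁ }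

variable (C : T4PrintedShapeBanking.Consts) (T C₁ C₂ : ℝ)

/-- bank rate of the modified constants [folklore] -/
@[simp] theorem withBanks_κ₁ : (withBanks C T C₁ C₂).κ₁ = T * C₂ := rfl
/-- birth margin base of the modified constants [folklore] -/
@[simp] theorem withBanks_Eb : (withBanks C T C₁ C₂).Eb = T * C₂ := rfl
/-- fatness margin of the modified constants [folklore] -/
@[simp] theorem withBanks_μ : (withBanks C T C₁ C₂).μ = T * C₁ := rfl
/-- the quadratic birth constant is unchanged [folklore] -/
@[simp] theorem withBanks_a : (withBanks C T C₁ C₂).a = C.a := rfl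
/-- the profile amplitude is unchanged [folklore] -/
@[simp] theorem withBanks_A₀ : (withBanks C T C₁ C₂).A₀ = C.A₀ := rfl
/-- the profile exponent is unchanged [folklore] -/
@[simp] theorem withBanks_p₀ : (withBanks C T C₁ C₂).p₀ = C.p₀ := rfl
/-- the window power is unchanged [folklore] -/
@[simp] theorem withBanks_q' : (withBanks C T C₁ C₂).q' = C.q' := rfl
/-- the merger allowance is unchanged [folklore] -/
@[simp] theorem withBanks_n₁ : (withBanks C T C₁ C₂).n₁ = C.n₁ := rfl
/-- the per-step costs are unchanged [folklore] -/
theorem cost_withBanks (K : ℕ) (R : ℕ → ℕ) : cost (withBanks C T C₁ C₂) K R = cost C K R := rfl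
/-- the credits are unchanged [folklore] -/
theorem credit_withBanks (g : ℕ → ℝ) : credit (withBanks C T C₁ C₂) g = credit C g := rfl
/-- the reserves are unchanged [folklore] -/
theorem reserve_withBanks (g : ℕ → ℝ) : reserve (withBanks C T C₁ C₂) g = reserve C g := rfl
/-- the merger extensions are unchanged [folklore] -/
theorem extn_withBanks (K : ℕ) (R : ℕ → ℕ) : extn (withBanks C T C₁ C₂) K R = extn C K R := rfl
/-- the admissibility predicate is unchanged [folklore] -/
theorem consistent_withBanks (K : ℕ) (R : ℕ → ℕ) :
    ∀ G : Gen PEv, Consistent (withBanks C T C₁ C₂) K R G ↔ Consistent C K R G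
  | Gen.born _ _ => Iff.rfl
  | Gen.renew G _ _ => by
      simp only [Consistent, consistent_withBanks K R G, withBanks_n₁]
  | Gen.merge X Y _ => by
      simp only [Consistent, consistent_withBanks K R X, consistent_withBanks K R Y, withBanks_n₁]

variable {C T C₁ C₂}

/-- validity is preserved for a nonnegative rate and nonnegative volume constants [folklore] -/
theorem withBanks_valid (hC : C.Valid) (hT : 0 ≤ T) (hC₁ : 0 ≤ C₁) (hC₂ : 0 ≤ C₂) :
    (withBanks C T C₁ C₂).Valid where
  E₂_nonneg := hC.E₂_nonneg
  E₃_nonneg := hC.E₃_nonneg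
  κ₁_nonneg := mul_nonneg hT hC₂
  E₀_nonneg := hC.E₀_nonneg
  Eb_nonneg := mul_nonneg hT hC₂
  μ_nonneg := mul_nonneg hT hC₁
  dC_le := hC.dC_le

/-- **WITH THESE BANKS THE PER-CELL RATE IS `T`**: `rateB (T·C₂) (T·C₂) (T·C₁) C₁ C₂ = T`. [folklore] -/
theorem rateB_withBanks (hC₁ : 0 < C₁) (hC₂ : 0 < C₂) :
    rateB (withBanks C T C₁ C₂).κ₁ (withBanks C T C₁ C₂).Eb (withBanks C T C₁ C₂).μ C₁ C₂ = T := by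
  simp only [withBanks_κ₁, withBanks_Eb, withBanks_μ, rateB, min_self]
  rw [mul_div_cancel_right₀ T hC₂.ne', mul_div_cancel_right₀ T hC₁.ne', min_self]

/-- **SURVIVAL**: with banks at a rate `T > log Δ₁ + c₃` the route's ratio is below one:
`Δ₁ · e^{−(rateB − c₃)} < 1` (the binder `hϱ` of `SpaceTimeOccBridge.exists_relWeightBound_of_occLeaves` with
`s₁ := rateB − c₃`). [folklore] -/
theorem survival_withBanks {Δ₁ c₃ : ℝ} (hΔ : 0 < Δ₁) (hT : Real.log Δ₁ + c₃ < T) (hC₁ : 0 < C₁) (hC₂ : 0 < C₂) :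
    Δ₁ * Real.exp (-(rateB (withBanks C T C₁ C₂).κ₁ (withBanks C T C₁ C₂).Eb (withBanks C T C₁ C₂).μ C₁ C₂
      - c₃)) < 1 := by
  rw [rateB_withBanks hC₁ hC₂]
  exact survives_of_lt hΔ hT

end Banks

/-! ## §3 One infrared threshold for the banks at the survival rate -/

section Threshold

/-- **ONE INFRARED THRESHOLD, EVERY CUTOFF, AT ANY BANK RATE** — the COUNT member's `exists_irThreshold` applied to
the constants with banks at rate `T ≥ 0`: for valid base constants with `a, A₀ > 0`, `L ≥ 1`, `β₀ ≥ 0`, the exponent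
condition `r(q′+1) < p₀` and `C₁, C₂ ≥ 0`, there is `x₀` — depending on these and on `T` only, NOT on the cutoff — such
that along EVERY run of the typed flow with `log g_K⁻² ≥ x₀` the printed-shape data with banks `T·C₂ · W + Emarg`
inhabit `Banking`. [folklore] -/
theorem exists_irThreshold_withBanks (C : T4PrintedShapeBanking.Consts) (hC : C.Valid) (ha : 0 < C.a) (hA : 0 < C.A₀) {L r : ℕ}
    (hL : 1 ≤ L) {β₀ : ℝ} (hβ : 0 ≤ β₀) (hrq : r * (C.q' + 1) < C.p₀) {T C₁ C₂ : ℝ} (hT : 0 ≤ T)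
    (hC₁ : 0 ≤ C₁) (hC₂ : 0 ≤ C₂) :
    ∃ x₀ : ℝ, ∀ (K : ℕ) (R : ℕ → ℕ) (g : ℕ → ℝ) (β' : ℝ),
      B14.FlowIneq27 g β' β₀ C.p₀ K → B14FlowStep.FlowIneq29 R g L β' β₀ K →
      (∀ s, s ≤ K → B14.IsRj L r (g s) (R s)) → (∀ s, s ≤ K → 1 ≤ Real.log ((g s) ^ 2)⁻¹) →
      x₀ ≤ Real.log ((g K) ^ 2)⁻¹ →
        Banking (Consistent (withBanks C T C₁ C₂) K R) (dictW R (withBanks C T C₁ C₂).n₁)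
          (cost (withBanks C T C₁ C₂) K R) (credit (withBanks C T C₁ C₂) g)
          (fun e => (withBanks C T C₁ C₂).κ₁ * ((dictW R (withBanks C T C₁ C₂).n₁ e : ℕ) : ℝ) +
            Emarg (withBanks C T C₁ C₂) e)
          (reserve (withBanks C T C₁ C₂) g) (extn (withBanks C T C₁ C₂) K R) :=
  exists_irThreshold (withBanks C T C₁ C₂) (withBanks_valid hC hT hC₁ hC₂) ha hA hL hβ hrq

/-- **THE CONTOUR ROUTE'S SURVIVAL CONDITION IS AN INFRARED THRESHOLD.**  For valid base constants (`a, A₀ > 0`,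
`L ≥ 1`, `β₀ ≥ 0`, `r(q′+1) < p₀`), any site-animal constant `Δ₁ > 0`, multiplicity `c₃` and volume constants
`C₁, C₂ > 0`: with banks at the survival rate `T = survivalRate Δ₁ c₃` (i) the route survives,
`Δ₁·e^{−(rateB − c₃)} < 1`, and (ii) there is ONE `x₀`, free of the cutoff, past which print's banking holds along every
run of the typed flow — so that `SpaceTimeBankedRate.surplus_ge_rateB_printedShape` prices every lineage at the
surviving rate.  («for p₀ large and γ small enough», joint and `K`-uniform; nothing of Bałaban's asserted.) [folklore] -/
theorem survival_and_irThreshold (C : T4PrintedShapeBanking.Consts) (hC : C.Valid) (ha : 0 < C.a) (hA : 0 < C.A₀) {L r : ℕ}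
    (hL : 1 ≤ L) {β₀ : ℝ} (hβ : 0 ≤ β₀) (hrq : r * (C.q' + 1) < C.p₀) {Δ₁ c₃ C₁ C₂ : ℝ} (hΔ : 0 < Δ₁)
    (hC₁ : 0 < C₁) (hC₂ : 0 < C₂) :
    (withBanks C (survivalRate Δ₁ c₃) C₁ C₂).Valid ∧
    Δ₁ * Real.exp (-(rateB (withBanks C (survivalRate Δ₁ c₃) C₁ C₂).κ₁
      (withBanks C (survivalRate Δ₁ c₃) C₁ C₂).Eb (withBanks C (survivalRate Δ₁ c₃) C₁ C₂).μ C₁ C₂ - c₃)) < 1 ∧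
    ∃ x₀ : ℝ, ∀ (K : ℕ) (R : ℕ → ℕ) (g : ℕ → ℝ) (β' : ℝ),
      B14.FlowIneq27 g β' β₀ C.p₀ K → B14FlowStep.FlowIneq29 R g L β' β₀ K →
      (∀ s, s ≤ K → B14.IsRj L r (g s) (R s)) → (∀ s, s ≤ K → 1 ≤ Real.log ((g s) ^ 2)⁻¹) →
      x₀ ≤ Real.log ((g K) ^ 2)⁻¹ →
        Banking (Consistent (withBanks C (survivalRate Δ₁ c₃) C₁ C₂) K R)
          (dictW R (withBanks C (survivalRate Δ₁ c₃) C₁ C₂).n₁)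
          (cost (withBanks C (survivalRate Δ₁ c₃) C₁ C₂) K R) (credit (withBanks C (survivalRate Δ₁ c₃) C₁ C₂) g)
          (fun e => (withBanks C (survivalRate Δ₁ c₃) C₁ C₂).κ₁ *
              ((dictW R (withBanks C (survivalRate Δ₁ c₃) C₁ C₂).n₁ e : ℕ) : ℝ) +
            Emarg (withBanks C (survivalRate Δ₁ c₃) C₁ C₂) e)
          (reserve (withBanks C (survivalRate Δ₁ c₃) C₁ C₂) g)
          (extn (withBanks C (survivalRate Δ₁ c₃) C₁ C₂) K R) :=
  ⟨withBanks_valid hC (survivalRate_nonneg Δ₁ c₃) hC₁.le hC₂.le,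
    survival_withBanks hΔ (lt_survivalRate Δ₁ c₃) hC₁ hC₂,
    exists_irThreshold_withBanks C hC ha hA hL hβ hrq (survivalRate_nonneg Δ₁ c₃) hC₁.le hC₂.le⟩

end Threshold

/-! ## §4 Sanity: the rate and the survival on numbers -/

section Sanity

/-- With `C₁ = 2`, `C₂ = 3` and `T = 5` the banks are `κ₁ = Eb = 15`, `μ = 10`, and the rate is `5`. [folklore] -/
example (C : T4PrintedShapeBanking.Consts) : rateB (withBanks C 5 2 3).κ₁ (withBanks C 5 2 3).Eb (withBanks C 5 2 3).μ 2 3 = 5 :=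
  rateB_withBanks (by norm_num) (by norm_num)

/-- A rate `3` beats `log 2 + 1 < 3` (`log 2 < 1`): `2·e^{−(3−1)} < 1`. [folklore] -/
example : (2 : ℝ) * Real.exp (-(3 - 1)) < 1 :=
  survives_of_lt (by norm_num) (by
    have : Real.log 2 < 1 := by
      have h := Real.log_two_lt_d9
      linarith
    linarith)

end Sanity

end

end Summit.QuantumFields.BalabanUV.T4Continuum.SpaceTimePeierls
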